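import Summits.HodgeConjecture.HodgeConjecture.Theorems.Ring2AbelianAllWeilSign
import HarnessLib

/-!
# `2` is not a norm from `ℚ(√-3)`: the cell `NonsplitSixfolds[ℚ(√-3), -2]` is a NON-split component (WEIL-2 gen 17, door (h))

research route, not a corollary; conditional on HC_CM plus one named minimal statement.

Cell `pub-hodge-ring2-ab-*` (ALL ABELIAN VARIETIES), seat WEIL-2 gen 17, LEMMA R / THEOREM H2″ of
`run/shared/lean/pub/pub-hodge-ring2/pub-hodge-ring2-ab-weil-2/FMTRANSPORT-G17.md`.  The non-split `(ℚ(√-3), (3,3))` Weil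
component of the cell `NonsplitSixfolds` is the one of discriminant class `[-2] ∈ ℚˣ/Nm(ℚ(√-3)ˣ)` (Deligne's product
anchors `E_ω³ × Ē_ω³` with polarization type `(1,1,1,1,1,2)`); the split class is `[(-1)³] = [-1]`
(`Ring2.Hypotheses.splitDiscriminantClass 3 3`, van Geemen (5.4.1) / Landherr).  That these two classes DIFFER — i.e.
that `2` is not a norm from `K = ℚ(√-3)` — is used by every row of the cell and is the arithmetic input of LEMMA R of
the gen-17 account (an `A₅`-type ℚ-subgroup of `SO(6𝕌)` has ℚ-rank ≥ 3, whereas `SU(H₋₂)` has ℚ-rank ≤ 2 because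
`H₋₂` is not hyperbolic, because `[-2] ≠ [-1]`), hence of THEOREM H2″ (no Fourier–Mukai transport of Künneth-
decomposable objects — in particular of Markman's secant^{⊠2} sheaves — into the non-split cell).  It had not been
proved in the tree (the rows carry `δ ≠ splitDiscriminantClass 3 d` as a hypothesis).

## What is proved (0 sorry, no `def`, no named fact; `HC_CM` does not occur)

* `int_eq_zero_of_sq_add_three_sq_eq_two_sq` — the only integer solution of `x² + 3y² = 2z²` is `0`
  (descent at the prime `3`: `x² ≡ 2z² (mod 3)` forces `3 ∣ x, 3 ∣ z`, then `3 ∣ y`).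
* `not_exists_sq_add_three_sq_eq_two` — `¬ ∃ a b : ℚ, a² + 3b² = 2` (clear denominators).
* `norm_ne_two` — no element of `K₃ = ℚ[X]/(X² + 3)` has norm `2` (`Nm(a + b√-3) = a² + 3b²`,
  `Ring2.AbelianAll.norm_weilField_mk` of ab-weil-1 gen 7).
* `two_not_mem_normUnitsSubgroup` — `2 ∉ Nm(K₃ˣ)`.
* `negTwo_ne_splitDiscriminantClass` — `[-2] ≠ [(-1)³]` in `ℚˣ/Nm(K₃ˣ)`
  (`VanGeemen1994.weilNormResidueGroup 3`): the cell's component is not the split one.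

## References

* [vanGeemen1994HodgeAV] B. van Geemen, An introduction to the Hodge conjecture for abelian varieties, LNM 1594
  (1994), 4.14, Lemma 5.2 (3), (5.4.1).
* [Markman2025SecantWeil] E. Markman, arXiv:2502.03415 (preprint, unrefereed), §1.1 (discriminant `(-1)ⁿ` of the
  secant construction) — context only, not used.
-/

noncomputable section

open Polynomial
open Literature.AlgebraicGeometry.Motives
open Literature.AlgebraicGeometry.VanGeemen1994
open Summit.HodgeConjecture.HodgeConjecture.Ring2.Hypotheses
open Summit.HodgeConjecture.HodgeConjecture.Ring2.AbelianAll

namespace Summit.HodgeConjecture.Ring2AbelianAll.NonsplitNormObstruction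

/-- Squares modulo `3`: `a² = 2c²` in `ℤ/3` forces `a = c = 0`.
research route, not a corollary; conditional on HC_CM plus one named minimal statement. [folklore] -/
theorem zmod3_sq_eq_two_mul_sq (a c : ZMod 3) (h : a ^ 2 = 2 * c ^ 2) : a = 0 ∧ c = 0 := by
  revert a c h
  decide

/-- `t² = 0` in `ℤ/3` forces `t = 0`.
research route, not a corollary; conditional on HC_CM plus one named minimal statement. [folklore] -/
theorem zmod3_sq_eq_zero (t : ZMod 3) (h : t ^ 2 = 0) : t = 0 := by
  revert t h
  decide

/-- **Descent at `3`: the integer equation `x² + 3y² = 2z²` forces `z = 0`.**  (`x² ≡ 2z² (mod 3)` gives `3 ∣ x`,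
`3 ∣ z`; then `y² = 3(2z'² - x'²)` gives `3 ∣ y`, and `(x/3, y/3, z/3)` is a smaller solution.)
research route, not a corollary; conditional on HC_CM plus one named minimal statement. [folklore] -/
theorem eq_zero_of_sq_add_three_sq_eq_two_sq :
    ∀ (n : ℕ) (x y z : ℤ), z.natAbs = n → x ^ 2 + 3 * y ^ 2 = 2 * z ^ 2 → z = 0 := by
  intro n
  induction n using Nat.strong_induction_on with
  | _ n ih =>
    intro x y z hn h
    by_contra hz
    have h30 : (3 : ZMod 3) = 0 := by decide
    have h3 : ((x : ZMod 3)) ^ 2 = 2 * ((z : ZMod 3)) ^ 2 := by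
      have hc := congrArg (Int.cast : ℤ → ZMod 3) h
      push_cast at hc
      rw [h30, zero_mul, add_zero] at hc
      exact hc
    obtain ⟨hx0, hz0⟩ := zmod3_sq_eq_two_mul_sq _ _ h3
    obtain ⟨x', hx'⟩ := (ZMod.intCast_zmod_eq_zero_iff_dvd x 3).1 hx0
    obtain ⟨z', hz'⟩ := (ZMod.intCast_zmod_eq_zero_iff_dvd z 3).1 hz0
    have hx3 : x = 3 * x' := by simpa using hx'
    have hz3 : z = 3 * z' := by simpa using hz'
    subst hx3 hz3
    have h9 : (3 : ℤ) * (3 * x' ^ 2 + y ^ 2) = 3 * (6 * z' ^ 2) := by linear_combination h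
    have h1 : 3 * x' ^ 2 + y ^ 2 = 6 * z' ^ 2 := mul_left_cancel₀ (by norm_num) h9
    have hy : ((y : ZMod 3)) ^ 2 = 0 := by
      have hc := congrArg (Int.cast : ℤ → ZMod 3) h1
      push_cast at hc
      rw [h30, zero_mul, zero_add, show (6 : ZMod 3) = 0 by decide, zero_mul] at hc
      exact hc
    obtain ⟨y', hy'⟩ := (ZMod.intCast_zmod_eq_zero_iff_dvd y 3).1 (zmod3_sq_eq_zero _ hy)
    have hy3 : y = 3 * y' := by simpa using hy'
    subst hy3
    have h27 : (3 : ℤ) * (x' ^ 2 + 3 * y' ^ 2) = 3 * (2 * z' ^ 2) := by linear_combination h1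
    have h' : x' ^ 2 + 3 * y' ^ 2 = 2 * z' ^ 2 := mul_left_cancel₀ (by norm_num) h27
    have hz' : z' ≠ 0 := by
      rintro rfl
      exact hz (by simp)
    have hlt : z'.natAbs < n := by
      rw [← hn, Int.natAbs_mul]
      have h3abs : (3 : ℤ).natAbs = 3 := by decide
      rw [h3abs]
      have hpos : 0 < z'.natAbs := Int.natAbs_pos.2 hz'
      omega
    exact hz' (ih _ hlt x' y' z' rfl h')

/-- **The only integer solution of `x² + 3y² = 2z²` is `x = y = z = 0`.**
research route, not a corollary; conditional on HC_CM plus one named minimal statement. [folklore] -/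
theorem int_eq_zero_of_sq_add_three_sq_eq_two_sq (x y z : ℤ) (h : x ^ 2 + 3 * y ^ 2 = 2 * z ^ 2) :
    x = 0 ∧ y = 0 ∧ z = 0 := by
  have hz : z = 0 := eq_zero_of_sq_add_three_sq_eq_two_sq _ x y z rfl h
  subst hz
  have hx : x ^ 2 = 0 := by nlinarith [sq_nonneg x, sq_nonneg y]
  have hy : y ^ 2 = 0 := by nlinarith [sq_nonneg x, sq_nonneg y]
  exact ⟨pow_eq_zero_iff (n := 2) (by norm_num) |>.1 hx, pow_eq_zero_iff (n := 2) (by norm_num) |>.1 hy, rfl⟩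

/-- **`2` is not of the form `a² + 3b²` with `a, b ∈ ℚ`** — i.e. `2 ∉ Nm(ℚ(√-3)ˣ)`.
research route, not a corollary; conditional on HC_CM plus one named minimal statement. [folklore] -/
theorem not_exists_sq_add_three_sq_eq_two : ¬ ∃ a b : ℚ, a ^ 2 + 3 * b ^ 2 = 2 := by
  rintro ⟨a, b, h⟩
  have hz : ((a.den : ℤ) * b.den) ≠ 0 :=
    mul_ne_zero (Int.natCast_ne_zero.2 a.den_nz) (Int.natCast_ne_zero.2 b.den_nz)
  have key : (a.num * b.den : ℤ) ^ 2 + 3 * (b.num * a.den) ^ 2 = 2 * ((a.den : ℤ) * b.den) ^ 2 := by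
    have ha := Rat.mul_den_eq_num a
    have hb := Rat.mul_den_eq_num b
    have hq : ((a.num * b.den : ℤ) : ℚ) ^ 2 + 3 * ((b.num * a.den : ℤ) : ℚ) ^ 2 =
        2 * (((a.den : ℤ) * b.den : ℤ) : ℚ) ^ 2 := by
      push_cast
      rw [← ha, ← hb]
      linear_combination ((a.den : ℚ) * b.den) ^ 2 * h
    exact_mod_cast hq
  exact hz (int_eq_zero_of_sq_add_three_sq_eq_two_sq _ _ _ key).2.2

/-- **No element of `K₃ = ℚ[X]/(X² + 3)` has norm `2`** (`Nm(a + b√-3) = a² + 3b²`, ab-weil-1's `norm_weilField_mk`).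
research route, not a corollary; conditional on HC_CM plus one named minimal statement. [cite: vanGeemen1994HodgeAV, 4.14] -/
theorem norm_ne_two (k : weilField 3) : Algebra.norm ℚ k ≠ 2 := by
  obtain ⟨a, b, rfl⟩ := exists_eq_mk_linear 3 k
  rw [norm_weilField_mk]
  intro h
  exact not_exists_sq_add_three_sq_eq_two ⟨a, b, by exact_mod_cast h⟩

/-- **`2 ∉ Nm(K₃ˣ)`**: the unit `2 ∈ ℚˣ` is not in the norm subgroup of `K₃ = ℚ(√-3)`.
research route, not a corollary; conditional on HC_CM plus one named minimal statement. [cite: vanGeemen1994HodgeAV, 4.14] -/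
theorem two_not_mem_normUnitsSubgroup :
    Units.mk0 (2 : ℚ) two_ne_zero ∉ normUnitsSubgroup ℚ (weilField 3) := by
  intro hmem
  obtain ⟨k, hk⟩ := mem_normUnitsSubgroup_iff.1 hmem
  exact norm_ne_two (k : weilField 3) (by rw [hk]; rfl)

/-- A unit of `ℚ` whose norm-residue class is trivial has a value of the form `Nm(k)`; contrapositive form used below:
if `u ∈ Nm(K₃ˣ)` then `u⁻¹ ∈ Nm(K₃ˣ)`, so a class computation reduces to one forbidden value.
research route, not a corollary; conditional on HC_CM plus one named minimal statement. [folklore] -/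
theorem inv_two_not_mem_normUnitsSubgroup :
    (Units.mk0 (2 : ℚ) two_ne_zero)⁻¹ ∉ normUnitsSubgroup ℚ (weilField 3) := fun hmem =>
  two_not_mem_normUnitsSubgroup (by simpa using Subgroup.inv_mem _ hmem)

/-- **The cell's discriminant class is not the split class: `[-2] ≠ [(-1)³]` in `ℚˣ/Nm(ℚ(√-3)ˣ)`.**  By van Geemen
(5.4.1) / Landherr, `[(-1)ⁿ]` is the class of the hyperbolic (split) `(n,n)` Hermitian forms; Deligne's product anchors
`E_ω³ × Ē_ω³` with polarization type `(1⁵,2)` have `det H = -2`, and this theorem says their component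
(`NonsplitSixfolds[ℚ(√-3), -2]`) is genuinely non-split.  Consequence used in FMTRANSPORT-G17 LEMMA R: the cell's
form `H₋₂` has Witt index ≤ 2, so `SU(H₋₂)` has ℚ-rank ≤ 2.
research route, not a corollary; conditional on HC_CM plus one named minimal statement. [cite: vanGeemen1994HodgeAV, (5.4.1)] -/
theorem negTwo_ne_splitDiscriminantClass :
    (QuotientGroup.mk (Units.mk0 (-2 : ℚ) (by norm_num)) : weilNormResidueGroup 3) ≠ splitDiscriminantClass 3 3 := by
  intro h
  rw [splitDiscriminantClass, QuotientGroup.eq] at h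
  -- `(-2)⁻¹ * (-1)³ = 2⁻¹` as units of `ℚ`
  have hu : (Units.mk0 (-2 : ℚ) (by norm_num))⁻¹ * (-1 : ℚˣ) ^ 3 = (Units.mk0 (2 : ℚ) two_ne_zero)⁻¹ := by
    ext
    simp
    norm_num
  rw [hu] at h
  exact inv_two_not_mem_normUnitsSubgroup h

/-- The same statement for every ODD `n`: `[-2] ≠ [(-1)ⁿ]` (the `(n,n)` split class for odd `n` is `[-1]`).
research route, not a corollary; conditional on HC_CM plus one named minimal statement. [cite: vanGeemen1994HodgeAV, (5.4.1)] -/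
theorem negTwo_ne_splitDiscriminantClass_of_odd {n : ℕ} (hn : Odd n) :
    (QuotientGroup.mk (Units.mk0 (-2 : ℚ) (by norm_num)) : weilNormResidueGroup 3) ≠ splitDiscriminantClass n 3 := by
  have h3 : splitDiscriminantClass n 3 = splitDiscriminantClass 3 3 := by
    simp only [splitDiscriminantClass, hn.neg_one_pow, (by decide : Odd 3).neg_one_pow]
  rw [h3]
  exact negTwo_ne_splitDiscriminantClass

/-- For EVEN `n` the split class is `[1]`, and `[2] ≠ [1]`: the class `[2]` (e.g. of the `(2,2)` factor in the product
decompositions `(1,1)[-1] × (2,2)[2]` of the cell) is non-split as well.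
research route, not a corollary; conditional on HC_CM plus one named minimal statement. [cite: vanGeemen1994HodgeAV, (5.4.1)] -/
theorem two_ne_splitDiscriminantClass_of_even {n : ℕ} (hn : Even n) :
    (QuotientGroup.mk (Units.mk0 (2 : ℚ) two_ne_zero) : weilNormResidueGroup 3) ≠ splitDiscriminantClass n 3 := by
  intro h
  rw [splitDiscriminantClass, hn.neg_one_pow, QuotientGroup.eq, mul_one] at h
  exact inv_two_not_mem_normUnitsSubgroup h

end Summit.HodgeConjecture.Ring2AbelianAll.NonsplitNormObstruction
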